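import Summits.MatrixMultiplication.OmegaCensus.DicyclicLawTwoGroupQuotient
import Summits.MatrixMultiplication.OmegaCensus.DicyclicLawZ4Z4Reduction
import HarnessLib

/-!
# The dicyclic law at `|A| = 128`, `A/⟨c₀⟩ ↠ ℤ₄ × ℤ₄`: the shape classes N1, N2, N3, B

ω-census `pub-omega`, family (b3), seat pub-omega-group gen 14.  Framing: lottery ticket; floor = certified bounds/negative
ranges.  VALUE: kernel theorems about the group-theoretic method (TPP capacity of dihedral-like groups); NOT progress on ω.

Gen 12's `2`-group class theorems (`DicyclicN1Law`, `DicyclicN2Stable`, `DicyclicN3Stable`, `DicyclicClassBStable`) are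
reused verbatim up to their last line: each produces a member stable under a central involution (`n2_parts_periodic_aux`,
`n3_stable_member_aux`, `classB_parts_periodic`) or the four-coset cover (`n1_four_cosets`); the conclusion is now drawn from
`no_dicyclic_law_of_stable_member_128` and `not_four_cosets_of_onto_z4z4` (`DicyclicLawZ4Z4Reduction.lean`), i.e. with the
three characters onto `𝔽₂³` replaced by `Φ : A ↠ ℤ₄²`, `Φ c₀ = 0`.  Assembly in `DicyclicLaw128.lean`.
-/

namespace Summit.MatrixMultiplication.OmegaCensus

open Literature.Combinatorics.Additive Finset

section Classes

variable {A : Type} [AddCommGroup A] [DecidableEq A] [Fintype A] {G : Type} [Group G] [DecidableEq G]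
  {ρ τ : A → G} {c₀ : A} {B : Type} [AddCommGroup B] [DecidableEq B] [Fintype B]

/-- Class N1, exact case (`|U₀| = |U₁| + 2`), `|A| = 128`-free version of `n1_false_of_exact` with the three characters
replaced by `Φ : A ↠ ℤ₄²`, `Φ c₀ = 0`: the four-coset cover of `n1_four_cosets` contradicts `not_four_cosets_of_onto_z4z4`.
[folklore] -/
theorem n1_false_of_exact_z4z4
    (hρρ : ∀ a b, ρ a * ρ b = ρ (a + b)) (hρτ : ∀ a b, ρ a * τ b = τ (b - a))
    (hτρ : ∀ a b, τ a * ρ b = τ (a + b)) (hττ : ∀ a b, τ a * τ b = ρ (c₀ + b - a)) (hc₀ : c₀ ≠ 0)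
    (hρ : Function.Injective ρ) (hτ : Function.Injective τ) (hne : ∀ a b, ρ a ≠ τ b)
    (Φ : A →+ ZMod 4 × ZMod 4) (hΦ : Function.Surjective Φ) (hΦc : Φ c₀ = 0)
    (π : A →+ B) (hπ : Function.Surjective π) (hker : ∀ a : A, π a = 0 ↔ a = 0 ∨ a = c₀)
    {m : ℕ} (hB : ∀ b : B, (2 ^ m) • b = 0)
    {S T U : Finset G} (h : TripleProductProperty S T U)
    (hs₀ : (univ.filter fun a : A => ρ a ∈ S).card = 1) (hs₁ : (univ.filter fun a : A => τ a ∈ S).card = 1)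
    (ht₀ : (univ.filter fun a : A => ρ a ∈ T).card = 2) (ht₁ : (univ.filter fun a : A => τ a ∈ T).card = 2)
    (hcard : (univ.filter fun a : A => ρ a ∈ U).card = (univ.filter fun a : A => τ a ∈ U).card + 2)
    (hex : 4 * (univ.filter fun a : A => ρ a ∈ U).card + 2 * (univ.filter fun a : A => τ a ∈ U).card =
      Fintype.card A) : False := by
  -- the elements of the small parts
  obtain ⟨s₀, hS₀⟩ := card_eq_one.1 hs₀
  obtain ⟨s₁, hS₁⟩ := card_eq_one.1 hs₁
  obtain ⟨t₀, t₀', htt₀, hT₀'⟩ := card_eq_two.1 ht₀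
  obtain ⟨t₁, t₁', htt₁, hT₁'⟩ := card_eq_two.1 ht₁
  have hT₀ : (univ.filter fun a : A => ρ a ∈ T) = {t₀, t₀ + (t₀' - t₀)} := by rw [add_sub_cancel]; exact hT₀'
  have hT₁ : (univ.filter fun a : A => τ a ∈ T) = {t₁, t₁ + (t₁' - t₁)} := by rw [add_sub_cancel]; exact hT₁'
  have he₀ : t₀' - t₀ ≠ 0 := sub_ne_zero.2 htt₀.symm
  have he₁ : t₁' - t₁ ≠ 0 := sub_ne_zero.2 htt₁.symm
  set e₀ := t₀' - t₀ with he₀d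
  set e₁ := t₁' - t₁ with he₁d
  -- data of the triple itself (vertex `000`)
  obtain ⟨⟨f₀₀, f₀₁, f₁₀, f₁₁⟩, ⟨h12, h13, h23⟩, ⟨p₀₀, p₀₁, p₁₀⟩, hsub⟩ :=
    n1_vertex_data hρρ hρτ hτρ hττ hρ hτ hne h hS₀ hS₁ hT₀ hT₁ he₀ he₁ hex
  -- the `T·τ0`-translate (vertex `010`)
  have er : (Equiv.mulRight (1 : G)).toEmbedding = Function.Embedding.refl G := by ext x; simp
  have h' : TripleProductProperty S (T.map (Equiv.mulRight (τ 0)).toEmbedding) U := by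
    have := h.map_mulRight 1 (τ 0) 1; simpa only [er, Finset.map_refl] using this
  have hT'₀ : (univ.filter fun a : A => ρ a ∈ T.map (Equiv.mulRight (τ 0)).toEmbedding) =
      {-c₀ - (t₁ + e₁), -c₀ - (t₁ + e₁) + e₁} := by
    rw [rho_part_mulRight_tau hρρ hρτ hττ T, hT₁, image_insert, image_singleton,
      show -c₀ - t₁ = -c₀ - (t₁ + e₁) + e₁ by abel, pair_comm]
  have hT'₁ : (univ.filter fun a : A => τ a ∈ T.map (Equiv.mulRight (τ 0)).toEmbedding) =
      {-(t₀ + e₀), -(t₀ + e₀) + e₀} := by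
    rw [tau_part_mulRight_tau hρρ hττ T, hT₀, image_insert, image_singleton,
      show -t₀ = -(t₀ + e₀) + e₀ by abel, pair_comm]
  obtain ⟨-, ⟨k12, k13, k23⟩, ⟨-, p₁₁, -⟩, -⟩ :=
    n1_vertex_data hρρ hρτ hτρ hττ hρ hτ hne h' hS₀ hS₁ hT'₀ hT'₁ he₁ he₀ hex
  -- the four cosets
  obtain ⟨g, z, hcov⟩ := n1_four_cosets π hπ hker hc₀ hB f₀₀ f₀₁ f₁₀ f₁₁ hcard hex.symm h12 h13 h23 k12 k13 k23
    (by abel) (by abel) rfl p₀₀ p₀₁ p₁₀ p₁₁ hsub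
  exact not_four_cosets_of_onto_z4z4 Φ hΦ hΦc hcov

/-- **Class N1 at `|A| = 128`** (`(1,1 | 2,2 | k−1,k+1)`): no such TPP triple attains the dicyclic law when
`Φ : A ↠ ℤ₄²` kills `c₀`, `π : A ↠ B` has kernel `{0, c₀}` and `B` is a `2`-group. [folklore] -/
theorem no_n1_dicyclic_law_z4z4
    (hρρ : ∀ a b, ρ a * ρ b = ρ (a + b)) (hρτ : ∀ a b, ρ a * τ b = τ (b - a))
    (hτρ : ∀ a b, τ a * ρ b = τ (a + b)) (hττ : ∀ a b, τ a * τ b = ρ (c₀ + b - a)) (hc₀ : c₀ ≠ 0)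
    (hρ : Function.Injective ρ) (hτ : Function.Injective τ) (hne : ∀ a b, ρ a ≠ τ b)
    (hsurj : ∀ g, (∃ a, ρ a = g) ∨ (∃ a, τ a = g))
    (Φ : A →+ ZMod 4 × ZMod 4) (hΦ : Function.Surjective Φ) (hΦc : Φ c₀ = 0)
    (π : A →+ B) (hπ : Function.Surjective π) (hker : ∀ a : A, π a = 0 ↔ a = 0 ∨ a = c₀)
    {m : ℕ} (hB : ∀ b : B, (2 ^ m) • b = 0)
    {S T U : Finset G} (h : TripleProductProperty S T U)
    (hs₀ : (univ.filter fun a : A => ρ a ∈ S).card = 1) (hs₁ : (univ.filter fun a : A => τ a ∈ S).card = 1)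
    (ht₀ : (univ.filter fun a : A => ρ a ∈ T).card = 2) (ht₁ : (univ.filter fun a : A => τ a ∈ T).card = 2)
    (hU : (univ.filter fun a : A => ρ a ∈ U).card ≠ (univ.filter fun a : A => τ a ∈ U).card) :
    3 * (S.card * T.card * U.card) + 16 ≠ 8 * Fintype.card A := by
  intro hV
  have cS : S.card = 2 := by rw [card_eq_parts' hρ hτ hne hsurj S, hs₀, hs₁]
  have cT : T.card = 4 := by rw [card_eq_parts' hρ hτ hne hsurj T, ht₀, ht₁]
  have cU := card_eq_parts' hρ hτ hne hsurj U
  have h8 : 8 ∣ Fintype.card A := Dvd.dvd.trans (by norm_num) (sixteen_dvd_card_of_onto_z4z4 Φ hΦ)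
  obtain ⟨h000, h111, -⟩ := vertex_counting' hρρ hρτ hτρ hττ hρ hτ hne h
  rw [hs₀, hs₁, ht₀, ht₁] at h000 h111
  rw [cS, cT, cU] at hV
  set u₀ := (univ.filter fun a : A => ρ a ∈ U).card with hu₀
  set u₁ := (univ.filter fun a : A => τ a ∈ U).card with hu₁
  obtain ⟨q, hq⟩ := h8
  by_cases hcase : u₀ = u₁ + 2
  · exact n1_false_of_exact_z4z4 hρρ hρτ hτρ hττ hc₀ hρ hτ hne Φ hΦ hΦc π hπ hker hB h hs₀ hs₁ ht₀ ht₁ hcase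
      (by omega)
  · have hcase' : u₁ = u₀ + 2 := by omega
    have er : (Equiv.mulRight (1 : G)).toEmbedding = Function.Embedding.refl G := by ext x; simp
    have h' : TripleProductProperty S T (U.map (Equiv.mulRight (τ 0)).toEmbedding) := by
      have := h.map_mulRight 1 1 (τ 0); simpa only [er, Finset.map_refl] using this
    have cU'₀ := card_rho_part_mulRight_tau hρρ hρτ hττ (A := A) U
    have cU'₁ := card_tau_part_mulRight_tau hρρ hττ (A := A) U
    exact n1_false_of_exact_z4z4 hρρ hρτ hτρ hττ hc₀ hρ hτ hne Φ hΦ hΦc π hπ hker hB h' hs₀ hs₁ ht₀ ht₁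
      (by rw [cU'₀, cU'₁]; omega) (by rw [cU'₀, cU'₁]; omega)

/-- **Class N2 at `|A| = 128`** (`(1,1 | a,a+1 | 4,4)`): `U` is `ρ(c₀)`-stable (`n2_parts_periodic_aux`), then
`no_dicyclic_law_of_stable_member_128`. [folklore] -/
theorem no_n2_dicyclic_law_128
    (hρρ : ∀ a b, ρ a * ρ b = ρ (a + b)) (hρτ : ∀ a b, ρ a * τ b = τ (b - a))
    (hτρ : ∀ a b, τ a * ρ b = τ (a + b)) (hττ : ∀ a b, τ a * τ b = ρ (c₀ + b - a)) (hc₀ : c₀ ≠ 0)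
    (hρ : Function.Injective ρ) (hτ : Function.Injective τ) (hne : ∀ a b, ρ a ≠ τ b)
    (hsurj : ∀ g, (∃ a, ρ a = g) ∨ (∃ a, τ a = g)) (hA : Fintype.card A = 128)
    (Φ : A →+ ZMod 4 × ZMod 4) (hΦ : Function.Surjective Φ) (hΦc : Φ c₀ = 0)
    (π : A →+ B) (hker : ∀ a : A, π a = 0 ↔ a = 0 ∨ a = c₀) {m : ℕ} (hB : ∀ b : B, (2 ^ m) • b = 0)
    {S T U : Finset G} (h : TripleProductProperty S T U)
    (hs₀ : (univ.filter fun a : A => ρ a ∈ S).card = 1) (hs₁ : (univ.filter fun a : A => τ a ∈ S).card = 1)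
    (hu₀ : (univ.filter fun a : A => ρ a ∈ U).card = 4) (hu₁ : (univ.filter fun a : A => τ a ∈ U).card = 4) :
    3 * (S.card * T.card * U.card) + 16 ≠ 8 * Fintype.card A := by
  intro hV
  have cS : S.card = 2 := by rw [card_eq_parts' hρ hτ hne hsurj S, hs₀, hs₁]
  have cU : U.card = 8 := by rw [card_eq_parts' hρ hτ hne hsurj U, hu₀, hu₁]
  have cT := card_eq_parts' hρ hτ hne hsurj T
  obtain ⟨h000, h111, -⟩ := vertex_counting' hρρ hρτ hτρ hττ hρ hτ hne h
  rw [hs₀, hs₁, hu₀, hu₁] at h000 h111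
  rw [cS, cT, cU] at hV
  set t₀ := (univ.filter fun a : A => ρ a ∈ T).card with ht₀
  set t₁ := (univ.filter fun a : A => τ a ∈ T).card with ht₁
  have h2c := two_c0_eq_zero hρτ hτρ hττ hτ
  have key : (univ.filter fun a : A => ρ a ∈ U).image (· + c₀) = (univ.filter fun a : A => ρ a ∈ U) ∧
      (univ.filter fun a : A => τ a ∈ U).image (· + c₀) = (univ.filter fun a : A => τ a ∈ U) := by
    by_cases hcase : t₁ = t₀ + 1
    · have hodd : Odd t₁ := ⟨t₀ / 2, by omega⟩
      exact n2_parts_periodic_aux hρρ hρτ hτρ hττ hc₀ hρ hτ hne π hker hB h hs₀ hs₁ hodd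
        (by rw [hu₀, hu₁]; omega)
    · have hcase' : t₀ = t₁ + 1 := by omega
      have er : (Equiv.mulRight (1 : G)).toEmbedding = Function.Embedding.refl G := by ext x; simp
      have h' : TripleProductProperty S (T.map (Equiv.mulRight (τ 0)).toEmbedding) U := by
        have := h.map_mulRight 1 (τ 0) 1; simpa only [er, Finset.map_refl] using this
      have cT'₀ := card_rho_part_mulRight_tau hρρ hρτ hττ (A := A) T
      have cT'₁ := card_tau_part_mulRight_tau hρρ hττ (A := A) T
      have hodd : Odd (univ.filter fun a : A => τ a ∈ T.map (Equiv.mulRight (τ 0)).toEmbedding).card := by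
        rw [cT'₁]; exact ⟨t₁ / 2, by omega⟩
      exact n2_parts_periodic_aux hρρ hρτ hτρ hττ hc₀ hρ hτ hne π hker hB h' hs₀ hs₁ hodd
        (by rw [cT'₀, cT'₁, hu₀, hu₁]; omega)
  obtain ⟨hU₀, hU₁⟩ := key
  have hstab : ∀ x ∈ U, x * ρ c₀ ∈ U := stable_of_parts_periodic hρρ hτρ hsurj hU₀ hU₁
  have hV' : 3 * (S.card * T.card * U.card) + 16 = 8 * Fintype.card A := by rw [cS, cT, cU]; exact hV
  exact no_dicyclic_law_of_stable_member_128 hρρ hρτ hτρ hττ hc₀ hρ hτ hne hsurj hA Φ hΦ hΦc h h2c hc₀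
    (Or.inr (Or.inr hstab)) hV'

/-- **Class N3 at `|A| = 128`** (`(2,2 | 2,2 | u,u+1)`): `S` or `T` is stable under a central involution
(`n3_stable_member_aux`), then `no_dicyclic_law_of_stable_member_128`. [folklore] -/
theorem no_n3_dicyclic_law_128
    (hρρ : ∀ a b, ρ a * ρ b = ρ (a + b)) (hρτ : ∀ a b, ρ a * τ b = τ (b - a))
    (hτρ : ∀ a b, τ a * ρ b = τ (a + b)) (hττ : ∀ a b, τ a * τ b = ρ (c₀ + b - a)) (hc₀ : c₀ ≠ 0)
    (hρ : Function.Injective ρ) (hτ : Function.Injective τ) (hne : ∀ a b, ρ a ≠ τ b)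
    (hsurj : ∀ g, (∃ a, ρ a = g) ∨ (∃ a, τ a = g)) (hA : Fintype.card A = 128)
    (Φ : A →+ ZMod 4 × ZMod 4) (hΦ : Function.Surjective Φ) (hΦc : Φ c₀ = 0)
    (π : A →+ B) (hker : ∀ a : A, π a = 0 ↔ a = 0 ∨ a = c₀) {m : ℕ} (hB : ∀ b : B, (2 ^ m) • b = 0)
    {S T U : Finset G} (h : TripleProductProperty S T U)
    (hs₀ : (univ.filter fun a : A => ρ a ∈ S).card = 2) (hs₁ : (univ.filter fun a : A => τ a ∈ S).card = 2)
    (ht₀ : (univ.filter fun a : A => ρ a ∈ T).card = 2) (ht₁ : (univ.filter fun a : A => τ a ∈ T).card = 2) :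
    3 * (S.card * T.card * U.card) + 16 ≠ 8 * Fintype.card A := by
  intro hV
  have cS : S.card = 4 := by rw [card_eq_parts' hρ hτ hne hsurj S, hs₀, hs₁]
  have cT : T.card = 4 := by rw [card_eq_parts' hρ hτ hne hsurj T, ht₀, ht₁]
  have cU := card_eq_parts' hρ hτ hne hsurj U
  obtain ⟨-, -, h000, h111⟩ := parts_counting' hρρ hρτ hτρ hττ hρ hτ hne h
  rw [hs₀, hs₁, ht₀, ht₁] at h000 h111
  rw [cS, cT, cU] at hV
  set u₀ := (univ.filter fun a : A => ρ a ∈ U).card with hu₀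
  set u₁ := (univ.filter fun a : A => τ a ∈ U).card with hu₁
  have key : ∃ a : A, a + a = 0 ∧ a ≠ 0 ∧ ((∀ x ∈ S, x * ρ a ∈ S) ∨ (∀ x ∈ T, x * ρ a ∈ T)) := by
    by_cases hcase : u₁ = u₀ + 1
    · have hodd : Odd u₁ := ⟨u₀ / 2, by omega⟩
      exact n3_stable_member_aux hρρ hρτ hτρ hττ hc₀ hρ hτ hne hsurj π hker hB h hs₀ hs₁ ht₀ ht₁ hodd (by omega)
    · have hcase' : u₀ = u₁ + 1 := by omega
      have er : (Equiv.mulRight (1 : G)).toEmbedding = Function.Embedding.refl G := by ext x; simp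
      have h' : TripleProductProperty S T (U.map (Equiv.mulRight (τ 0)).toEmbedding) := by
        have := h.map_mulRight 1 1 (τ 0); simpa only [er, Finset.map_refl] using this
      have cU'₀ := card_rho_part_mulRight_tau hρρ hρτ hττ (A := A) U
      have cU'₁ := card_tau_part_mulRight_tau hρρ hττ (A := A) U
      have hodd : Odd (univ.filter fun a : A => τ a ∈ U.map (Equiv.mulRight (τ 0)).toEmbedding).card := by
        rw [cU'₁]; exact ⟨u₁ / 2, by omega⟩
      exact n3_stable_member_aux hρρ hρτ hτρ hττ hc₀ hρ hτ hne hsurj π hker hB h' hs₀ hs₁ ht₀ ht₁ hodd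
        (by rw [cU'₀, cU'₁]; omega)
  obtain ⟨a, ha2, ha0, hstab⟩ := key
  have hstab' : (∀ x ∈ S, x * ρ a ∈ S) ∨ (∀ x ∈ T, x * ρ a ∈ T) ∨ (∀ x ∈ U, x * ρ a ∈ U) := by
    rcases hstab with hs | ht
    · exact Or.inl hs
    · exact Or.inr (Or.inl ht)
  have hV' : 3 * (S.card * T.card * U.card) + 16 = 8 * Fintype.card A := by rw [cS, cT, cU]; exact hV
  exact no_dicyclic_law_of_stable_member_128 hρρ hρτ hτρ hττ hc₀ hρ hτ hne hsurj hA Φ hΦ hΦc h ha2 ha0 hstab' hV'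

/-- **Class B at `|A| = 128`** (`(s,s | t,t | u,u)`): the even member is `ρ(c₀)`-stable (`classB_parts_periodic`), then
`no_dicyclic_law_of_stable_member_128`. [folklore] -/
theorem no_classB_dicyclic_law_128
    (hρρ : ∀ a b, ρ a * ρ b = ρ (a + b)) (hρτ : ∀ a b, ρ a * τ b = τ (b - a))
    (hτρ : ∀ a b, τ a * ρ b = τ (a + b)) (hττ : ∀ a b, τ a * τ b = ρ (c₀ + b - a)) (hc₀ : c₀ ≠ 0)
    (hρ : Function.Injective ρ) (hτ : Function.Injective τ) (hne : ∀ a b, ρ a ≠ τ b)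
    (hsurj : ∀ g, (∃ a, ρ a = g) ∨ (∃ a, τ a = g)) (hA : Fintype.card A = 128)
    (Φ : A →+ ZMod 4 × ZMod 4) (hΦ : Function.Surjective Φ) (hΦc : Φ c₀ = 0)
    (π : A →+ B) (hker : ∀ a : A, π a = 0 ↔ a = 0 ∨ a = c₀) {m : ℕ} (hB : ∀ b : B, (2 ^ m) • b = 0)
    {S T U : Finset G} (h : TripleProductProperty S T U)
    (hs : (univ.filter fun a : A => ρ a ∈ S).card = (univ.filter fun a : A => τ a ∈ S).card)
    (ht : (univ.filter fun a : A => ρ a ∈ T).card = (univ.filter fun a : A => τ a ∈ T).card)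
    (hu : (univ.filter fun a : A => ρ a ∈ U).card = (univ.filter fun a : A => τ a ∈ U).card) :
    3 * (S.card * T.card * U.card) + 16 ≠ 8 * Fintype.card A := by
  intro hV
  have h2c := two_c0_eq_zero hρτ hτρ hττ hτ
  set s := (univ.filter fun a : A => ρ a ∈ S).card with hsd
  set t := (univ.filter fun a : A => ρ a ∈ T).card with htd
  set u := (univ.filter fun a : A => ρ a ∈ U).card with hud
  have cS : S.card = s + s := by rw [card_eq_parts' hρ hτ hne hsurj S, ← hs]
  have cT : T.card = t + t := by rw [card_eq_parts' hρ hτ hne hsurj T, ← ht]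
  have cU : U.card = u + u := by rw [card_eq_parts' hρ hτ hne hsurj U, ← hu]
  have hV' := hV
  rw [cS, cT, cU, show (s + s) * (t + t) * (u + u) = 8 * (s * t * u) by ring] at hV'
  have hN : Fintype.card A = 3 * (s * t * u) + 2 := by omega
  have hP : s * t * u % 8 = 2 := by omega
  have key : ∃ a : A, a + a = 0 ∧ a ≠ 0 ∧
      ((∀ x ∈ S, x * ρ a ∈ S) ∨ (∀ x ∈ T, x * ρ a ∈ T) ∨ (∀ x ∈ U, x * ρ a ∈ U)) := by
    refine ⟨c₀, h2c, hc₀, ?_⟩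
    rcases Nat.even_or_odd s with hse | hso <;> rcases Nat.even_or_odd t with hte | hto <;>
      rcases Nat.even_or_odd u with hue | huo
    · exfalso; obtain ⟨a, ha⟩ := hse; obtain ⟨b, hb⟩ := hte
      rw [ha, hb, show (a + a) * (b + b) * u = 4 * (a * b * u) by ring] at hP; omega
    · exfalso; obtain ⟨a, ha⟩ := hse; obtain ⟨b, hb⟩ := hte
      rw [ha, hb, show (a + a) * (b + b) * u = 4 * (a * b * u) by ring] at hP; omega
    · exfalso; obtain ⟨a, ha⟩ := hse; obtain ⟨b, hb⟩ := hue
      rw [ha, hb, show (a + a) * t * (b + b) = 4 * (a * t * b) by ring] at hP; omega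
    · left
      obtain ⟨p₀, p₁⟩ := classB_parts_periodic hρρ hρτ hτρ hττ hc₀ hρ hτ hne π hker hB h.rotate htd.symm ht.symm
        hud.symm hu.symm hsd.symm hs.symm hto huo hse
        (by rw [hN, show t * u * s = s * t * u by ring])
      exact stable_of_parts_periodic hρρ hτρ hsurj p₀ p₁
    · exfalso; obtain ⟨a, ha⟩ := hte; obtain ⟨b, hb⟩ := hue
      rw [ha, hb, show s * (a + a) * (b + b) = 4 * (s * a * b) by ring] at hP; omega
    · right; left
      obtain ⟨p₀, p₁⟩ := classB_parts_periodic hρρ hρτ hτρ hττ hc₀ hρ hτ hne π hker hB h.rotate.rotate hud.symm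
        hu.symm hsd.symm hs.symm htd.symm ht.symm huo hso hte
        (by rw [hN, show u * s * t = s * t * u by ring])
      exact stable_of_parts_periodic hρρ hτρ hsurj p₀ p₁
    · right; right
      obtain ⟨p₀, p₁⟩ := classB_parts_periodic hρρ hρτ hτρ hττ hc₀ hρ hτ hne π hker hB h hsd.symm hs.symm
        htd.symm ht.symm hud.symm hu.symm hso hto hue (by rw [hN])
      exact stable_of_parts_periodic hρρ hτρ hsurj p₀ p₁
    · exfalso
      have hodd : Odd (s * t * u) := (hso.mul hto).mul huo
      obtain ⟨r, hr⟩ := hodd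
      omega
  obtain ⟨a, ha2, ha0, hstab⟩ := key
  exact no_dicyclic_law_of_stable_member_128 hρρ hρτ hτρ hττ hc₀ hρ hτ hne hsurj hA Φ hΦ hΦc h ha2 ha0 hstab hV

end Classes

end Summit.MatrixMultiplication.OmegaCensus
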